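import Literature.Analysis.FluidPDE.PassiveScalarDiagForcedClass
import HarnessLib

/-!
# Weak diagonal-diffusion passive scalars with a source, tested against smooth fields:
# the absolutely continuous representative of `t ↦ ∫ θ(t) φ(t)`

Analysis/FluidPDE proof-support file (everything proved). For a weak solution `θ` of
`∂ₜθ + u·∇θ = κ ∑ᵢ aᵢ ∂ᵢ∂ᵢθ + s` on `T^d × [0,T)` with datum `θ₀`
(`Torus.IsWeakScalarTransportDiagForcedOn T a κ u s θ₀ θ`, `PassiveScalarDiagForced`) and a field
`φ : ℝ → T^d → ℝ` with smooth space–time lift (no support condition), the pairing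
`t ↦ ∫ θ(t) φ(t)` has the absolutely continuous representative predicted by the equation: for
a.e. `t ∈ (0,T)`,

  `∫ θ(t) φ(t) = ∫ θ₀ φ(0) + ∫_{(0,t]} ( ∫ θ(τ) (∂ₜφ + ⟪u(τ), ∇φ(τ)⟫ + κ ∑ᵢ aᵢ ∂ᵢ∂ᵢφ(τ)) + ∫ s(τ) φ(τ) ) dτ`

(`IsWeakScalarTransportDiagForcedOn.ae_integral_mul_spaceTime_eq`; the weak formulation tested
with `η(t) φ(t, x)`, `….setIntegral_test_mul_spaceTime`, DiPerna–Lions 1989, (14), followed by the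
a.e. du Bois-Reymond lemma with datum `FunctionSpaces.ae_eq_add_setIntegral_of_forall_test`), its
steady case `….ae_integral_mul_eq` (`φ(t) = g` smooth, the twin of
`IsWeakScalarTransportForcedOn.ae_integral_mul_eq` of `PassiveScalarSteadyTest` with `κΔ` replaced
by `κ ∑ᵢ aᵢ ∂ᵢ∂ᵢ`), and **conservation of the mean up to the injected mass**
`∫ θ(t) = ∫ θ₀ + ∫_{(0,t]} ∫ s` (`….ae_integral_eq`). The time-dependent form is what the restart
property (`PassiveScalarDiagForcedRestart`) and the `L²` trace (`PassiveScalarDiagForcedTrace`)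
consume. The coefficient vector `a : d → ℝ` is arbitrary.

## Mathlib / tree search

Tree: `Torus.isSpaceTimeTest_mul`, `Torus.timeDeriv_mul` (`PassiveScalarFourier`, steady `g`),
`IsWeakScalarTransportForcedOn.setIntegral_test_mul` / `ae_integral_mul_eq` (`PassiveScalarSteadyTest`,
isotropic), `FunctionSpaces.ae_eq_add_setIntegral_of_forall_test` (`DuBoisReymondAE`),
`Torus.stLift_timeDeriv`, `Torus.partialDeriv_const_smul` (`TorusTestFunction`),
`Torus.gradient_const_mul` (`PassiveScalarProofs`). No time-dependent-test version of the
steady-test identity exists in the tree (`lean search setIntegral_test_mul`: the two steady ones).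

## References

* R. J. DiPerna, P.-L. Lions, Invent. Math. 98 (1989), §II.1, (13)–(14). [`DiPernaLions1989`]
* T. D. Drivas, T. M. Elgindi, G. Iyer, I.-J. Jeong, ARMA 243 (2022), §1, (1.1). [`DEIJ2022`]
* H. Brezis, *Functional Analysis, Sobolev Spaces and PDE* (2011), Lemma 8.1. [`Brezis2011`]
-/

noncomputable section

open _root_.MeasureTheory _root_.Set _root_.Filter _root_.Function _root_.TopologicalSpace
open scoped ENNReal NNReal InnerProductSpace ContDiff

namespace Literature.Analysis.FluidPDE

namespace Torus

variable {d : Type*} [Fintype d] [DecidableEq d]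

/-! ## Fields with smooth space–time lift: slices, derivatives, product test functions -/

section SmoothLift

variable {φ : ℝ → UnitAddTorus d → ℝ}

omit [DecidableEq d] in
/-- The time derivative of a field with smooth space–time lift has smooth space–time lift
(Mathlib `ContDiff.fderiv_apply`, as in `IsSpaceTimeTest.timeDeriv`). [folklore] -/
private theorem contDiff_stLift_timeDeriv_of_smooth (hφ : ContDiff ℝ ∞ (FunctionSpaces.Torus.stLift φ)) :
    ContDiff ℝ ∞ (FunctionSpaces.Torus.stLift (FunctionSpaces.Torus.timeDeriv φ)) := by
  rw [FunctionSpaces.Torus.stLift_timeDeriv]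
  refine ContDiff.fderiv_apply (m := ∞)
    (f := fun (p : ℝ × EuclideanSpace ℝ d) (τ : ℝ) => FunctionSpaces.Torus.stLift φ (τ, p.2)) ?_
    contDiff_fst contDiff_const (le_of_eq rfl)
  exact hφ.comp (contDiff_snd.prodMk (contDiff_snd.comp contDiff_fst))

omit [DecidableEq d] in
/-- Slices `τ ↦ φ τ x` of a field with smooth space–time lift are differentiable, with derivative
the time derivative. [folklore] -/
private theorem hasDerivAt_slice_of_contDiff_stLift (hφ : ContDiff ℝ ∞ (FunctionSpaces.Torus.stLift φ))
    (t : ℝ) (x : UnitAddTorus d) :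
    HasDerivAt (fun τ => φ τ x) (FunctionSpaces.Torus.timeDeriv φ t x) t := by
  obtain ⟨y, rfl⟩ := FunctionSpaces.Torus.proj_surjective x
  have h : (fun τ => φ τ (FunctionSpaces.Torus.proj y)) =
      FunctionSpaces.Torus.stLift φ ∘ fun τ => (τ, y) := by
    funext τ; simp [FunctionSpaces.Torus.stLift_apply]
  have hdiff : Differentiable ℝ (fun τ => φ τ (FunctionSpaces.Torus.proj y)) := by
    rw [h]
    exact (hφ.differentiable (by simp)).comp (differentiable_id.prodMk (differentiable_const _))
  exact (hdiff t).hasDerivAt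

omit [DecidableEq d] in
/-- The slices of a field with smooth space–time lift are smooth. [folklore] -/
private theorem isSmooth_slice_of_contDiff_stLift' (hφ : ContDiff ℝ ∞ (FunctionSpaces.Torus.stLift φ)) (t : ℝ) :
    FunctionSpaces.Torus.IsSmooth (φ t) :=
  hφ.comp (contDiff_prodMk_right t)

omit [DecidableEq d] in
/-- A field with smooth space–time lift is jointly smooth on every time set. [folklore] -/
private theorem isSmoothSpaceTimeOn_of_contDiff_stLift (hφ : ContDiff ℝ ∞ (FunctionSpaces.Torus.stLift φ))
    (S : Set ℝ) : FunctionSpaces.Torus.IsSmoothSpaceTimeOn S φ :=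
  hφ.contDiffOn

omit [DecidableEq d] in
/-- The time derivative of a field with smooth space–time lift is jointly continuous. [folklore] -/
private theorem continuous_uncurry_timeDeriv_of_contDiff_stLift'
    (hφ : ContDiff ℝ ∞ (FunctionSpaces.Torus.stLift φ)) :
    Continuous (uncurry (FunctionSpaces.Torus.timeDeriv φ)) :=
  FunctionSpaces.Torus.continuous_uncurry_of_continuous_stLift (contDiff_stLift_timeDeriv_of_smooth hφ).continuous

omit [DecidableEq d] in
/-- The gradient of a field with smooth space–time lift is jointly continuous. [folklore] -/
private theorem continuous_uncurry_gradient_of_contDiff_stLift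
    (hφ : ContDiff ℝ ∞ (FunctionSpaces.Torus.stLift φ)) :
    Continuous (uncurry fun t => FunctionSpaces.Torus.gradient (φ t)) := by
  classical
  have h := ((isSmoothSpaceTimeOn_of_contDiff_stLift hφ univ).gradient uniqueDiffOn_univ).continuousOn_stLift
  rw [univ_prod_univ, continuousOn_univ] at h
  exact FunctionSpaces.Torus.continuous_uncurry_of_continuous_stLift h

/-- Second spatial partial derivatives of a field with smooth space–time lift are jointly
continuous. [folklore] -/
private theorem continuous_uncurry_partialDeriv_partialDeriv_of_contDiff_stLift
    (hφ : ContDiff ℝ ∞ (FunctionSpaces.Torus.stLift φ)) (i j : d) :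
    Continuous (uncurry fun t x =>
      FunctionSpaces.Torus.partialDeriv i (FunctionSpaces.Torus.partialDeriv j (φ t)) x) := by
  have h := (((isSmoothSpaceTimeOn_of_contDiff_stLift hφ univ).partialDeriv uniqueDiffOn_univ j).partialDeriv
    uniqueDiffOn_univ i).continuousOn_stLift
  rw [univ_prod_univ, continuousOn_univ] at h
  exact FunctionSpaces.Torus.continuous_uncurry_of_continuous_stLift h

/-- The diagonal operator `(t, x) ↦ ∑ᵢ aᵢ ∂ᵢ∂ᵢ(φ t)(x)` of a field with smooth space–time lift
is jointly continuous. [folklore] -/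
private theorem continuous_uncurry_diagOp_of_contDiff_stLift
    (hφ : ContDiff ℝ ∞ (FunctionSpaces.Torus.stLift φ)) (a : d → ℝ) :
    Continuous (uncurry fun t x =>
      ∑ i, a i * FunctionSpaces.Torus.partialDeriv i (FunctionSpaces.Torus.partialDeriv i (φ t)) x) := by
  have e : (uncurry fun t x =>
      ∑ i, a i * FunctionSpaces.Torus.partialDeriv i (FunctionSpaces.Torus.partialDeriv i (φ t)) x) =
      fun p : ℝ × UnitAddTorus d => ∑ i, a i * (uncurry fun t x =>
        FunctionSpaces.Torus.partialDeriv i (FunctionSpaces.Torus.partialDeriv i (φ t)) x) p := by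
    funext p; rfl
  rw [e]
  exact continuous_finsetSum _ fun i _ =>
    continuous_const.mul (continuous_uncurry_partialDeriv_partialDeriv_of_contDiff_stLift hφ i i)

omit [DecidableEq d] in
/-- **Product test functions with a time-dependent field.** For a smooth compactly supported
`η : ℝ → ℝ` with `tsupport η ⊆ (-∞, T)` and a field `φ` with smooth space–time lift,
`(t, x) ↦ η(t) φ(t, x)` is a space–time test function on `T^d × [0,T)`. [folklore] -/
private theorem isSpaceTimeTest_mul_of_contDiff_stLift {T : ℝ} {η : ℝ → ℝ} (hη : ContDiff ℝ ∞ η)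
    (hηc : HasCompactSupport η) (hηT : tsupport η ⊆ Iio T)
    (hφ : ContDiff ℝ ∞ (FunctionSpaces.Torus.stLift φ)) :
    FunctionSpaces.Torus.IsSpaceTimeTest T (fun t x => η t * φ t x) := by
  refine ⟨?_, ?_⟩
  · have h : FunctionSpaces.Torus.stLift (fun t x => η t * φ t x) =
        fun p : ℝ × EuclideanSpace ℝ d => η p.1 * FunctionSpaces.Torus.stLift φ p := by
      funext p; rfl
    rw [h]
    exact (hη.comp contDiff_fst).mul hφ
  · obtain ⟨T', hT'T, hT'⟩ := FunctionSpaces.exists_lt_forall_eq_zero_of_tsupport_subset_Iio hηc hηT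
    exact ⟨T', hT'T, fun t ht => funext fun x => by simp [hT' t ht]⟩

omit [DecidableEq d] in
/-- Time derivative of the product test function: `∂ₜ(η φ) = η' φ + η ∂ₜφ`. [folklore] -/
private theorem timeDeriv_mul_of_contDiff_stLift (hφ : ContDiff ℝ ∞ (FunctionSpaces.Torus.stLift φ))
    {η : ℝ → ℝ} (hη : ContDiff ℝ ∞ η) (t : ℝ) (x : UnitAddTorus d) :
    FunctionSpaces.Torus.timeDeriv (fun t x => η t * φ t x) t x =
      deriv η t * φ t x + η t * FunctionSpaces.Torus.timeDeriv φ t x := by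
  have hη' : HasDerivAt η (deriv η t) t := ((hη.differentiable (by simp)) t).hasDerivAt
  exact (hη'.mul (hasDerivAt_slice_of_contDiff_stLift hφ t x)).deriv

omit [Fintype d] in
/-- `∂ᵢ (c f) = c ∂ᵢ f` pointwise, for real functions on `T^d` (no differentiability needed). [folklore] -/
private theorem partialDeriv_const_mul_apply' (c : ℝ) (f : UnitAddTorus d → ℝ) (i : d) (x : UnitAddTorus d) :
    FunctionSpaces.Torus.partialDeriv i (fun y => c * f y) x = c * FunctionSpaces.Torus.partialDeriv i f x := by
  simp only [FunctionSpaces.Torus.partialDeriv, FunctionSpaces.Torus.lineDeriv, deriv_const_mul_field']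

omit [Fintype d] in
/-- `∂ᵢ∂ᵢ (c f) = c ∂ᵢ∂ᵢ f` pointwise, for real functions on `T^d`. [folklore] -/
private theorem partialDeriv_partialDeriv_const_mul_apply (c : ℝ) (f : UnitAddTorus d → ℝ) (i : d)
    (x : UnitAddTorus d) :
    FunctionSpaces.Torus.partialDeriv i (FunctionSpaces.Torus.partialDeriv i (fun y => c * f y)) x =
      c * FunctionSpaces.Torus.partialDeriv i (FunctionSpaces.Torus.partialDeriv i f) x := by
  have e : FunctionSpaces.Torus.partialDeriv i (fun y => c * f y) =
      fun y => c * FunctionSpaces.Torus.partialDeriv i f y :=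
    funext fun y => partialDeriv_const_mul_apply' c f i y
  rw [e, partialDeriv_const_mul_apply']

/-- The diagonal operator of the product test function:
`∑ᵢ aᵢ ∂ᵢ∂ᵢ (η(t) φ(t)) = η(t) ∑ᵢ aᵢ ∂ᵢ∂ᵢ φ(t)`. [folklore] -/
private theorem diagOp_const_mul_apply (a : d → ℝ) (c : ℝ) (f : UnitAddTorus d → ℝ) (x : UnitAddTorus d) :
    (∑ i, a i * FunctionSpaces.Torus.partialDeriv i
        (FunctionSpaces.Torus.partialDeriv i (fun y => c * f y)) x) =
      c * ∑ i, a i * FunctionSpaces.Torus.partialDeriv i (FunctionSpaces.Torus.partialDeriv i f) x := by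
  rw [Finset.mul_sum]
  refine Finset.sum_congr rfl fun i _ => ?_
  rw [partialDeriv_partialDeriv_const_mul_apply]
  ring

end SmoothLift

namespace IsWeakScalarTransportDiagForcedOn

variable {T κ : ℝ} {a : d → ℝ} {u : ℝ → UnitAddTorus d → EuclideanSpace ℝ d}
  {s : ℝ → UnitAddTorus d → ℝ} {θ₀ : UnitAddTorus d → ℝ} {θ : ℝ → UnitAddTorus d → ℝ}
  {φ : ℝ → UnitAddTorus d → ℝ}

/-! ## The weak formulation tested with `η(t) φ(t, x)` -/

/-- **The weak formulation tested with `η(t) φ(t, x)`.** For a smooth compactly supported `η`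
with `tsupport η ⊆ (-∞, T)` and a field `φ` with smooth space–time lift,
`∫_{(0,T)} (η' ∫ θ φ + η (∫ θ (∂ₜφ + ⟪u, ∇φ⟫ + κ ∑ᵢ aᵢ ∂ᵢ∂ᵢφ) + ∫ s φ)) + η(0) ∫ θ₀ φ(0) = 0`
(DiPerna–Lions 1989, (13)–(14) with a right-hand side, diagonal diffusion).
[cite: DiPernaLions1989, §II.1 (13)–(14)] -/
theorem setIntegral_test_mul_spaceTime (h : IsWeakScalarTransportDiagForcedOn T a κ u s θ₀ θ)
    {η : ℝ → ℝ} (hη : ContDiff ℝ ∞ η) (hηc : HasCompactSupport η) (hηT : tsupport η ⊆ Iio T)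
    (hφ : ContDiff ℝ ∞ (FunctionSpaces.Torus.stLift φ)) :
    (∫ t in Ioo 0 T, ((deriv η t * ∫ x, θ t x * φ t x) +
      η t * ((∫ x, θ t x * (FunctionSpaces.Torus.timeDeriv φ t x +
        ⟪u t x, FunctionSpaces.Torus.gradient (φ t) x⟫_ℝ +
        κ * ∑ i, a i * FunctionSpaces.Torus.partialDeriv i
          (FunctionSpaces.Torus.partialDeriv i (φ t)) x)) + ∫ x, s t x * φ t x))) +
      η 0 * ∫ x, θ₀ x * φ 0 x = 0 := by
  have hψ := isSpaceTimeTest_mul_of_contDiff_stLift hη hηc hηT hφ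
  have key := h.integral_prod_weak_eq hψ
  set P : Measure (ℝ × UnitAddTorus d) := ((volume : Measure ℝ).restrict (Ioo 0 T)).prod volume
    with hP
  -- pointwise form of the two integrands
  have hpt : ∀ p : ℝ × UnitAddTorus d, θ p.1 p.2 *
      (FunctionSpaces.Torus.timeDeriv (fun t x => η t * φ t x) p.1 p.2 +
        ⟪u p.1 p.2, FunctionSpaces.Torus.gradient ((fun t x => η t * φ t x) p.1) p.2⟫_ℝ +
        κ * ∑ i, a i * FunctionSpaces.Torus.partialDeriv i
          (FunctionSpaces.Torus.partialDeriv i ((fun t x => η t * φ t x) p.1)) p.2) =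
      deriv η p.1 * (θ p.1 p.2 * φ p.1 p.2) +
        η p.1 * (θ p.1 p.2 * (FunctionSpaces.Torus.timeDeriv φ p.1 p.2 +
          ⟪u p.1 p.2, FunctionSpaces.Torus.gradient (φ p.1) p.2⟫_ℝ +
          κ * ∑ i, a i * FunctionSpaces.Torus.partialDeriv i
            (FunctionSpaces.Torus.partialDeriv i (φ p.1)) p.2)) := by
    intro p
    have hφ1 : FunctionSpaces.Torus.IsContDiff 1 (φ p.1) :=
      (isSmooth_slice_of_contDiff_stLift' hφ p.1).isContDiff (by simp)
    rw [timeDeriv_mul_of_contDiff_stLift hφ hη,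
      show (fun t x => η t * φ t x) p.1 = fun x => η p.1 * φ p.1 x from rfl,
      gradient_const_mul hφ1, real_inner_smul_right, diagOp_const_mul_apply]
    ring
  have hps : ∀ p : ℝ × UnitAddTorus d, s p.1 p.2 * (fun t x => η t * φ t x) p.1 p.2 =
      η p.1 * (s p.1 p.2 * φ p.1 p.2) := fun p => by simp only; ring
  obtain ⟨Ca, hCa⟩ := (hη.continuous_deriv (by simp)).bounded_above_of_compact_support hηc.deriv
  obtain ⟨Cb, hCb⟩ := hη.continuous.bounded_above_of_compact_support hηc
  set f₁ : ℝ × UnitAddTorus d → ℝ := fun p => deriv η p.1 * (θ p.1 p.2 * φ p.1 p.2) with hf₁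
  set f₂ : ℝ × UnitAddTorus d → ℝ := fun p =>
    η p.1 * (θ p.1 p.2 * (FunctionSpaces.Torus.timeDeriv φ p.1 p.2 +
      ⟪u p.1 p.2, FunctionSpaces.Torus.gradient (φ p.1) p.2⟫_ℝ +
      κ * ∑ i, a i * FunctionSpaces.Torus.partialDeriv i
        (FunctionSpaces.Torus.partialDeriv i (φ p.1)) p.2)) with hf₂
  set f₃ : ℝ × UnitAddTorus d → ℝ := fun p => η p.1 * (s p.1 p.2 * φ p.1 p.2) with hf₃
  have hI₁ := h.integrable_mul_of_continuous (FunctionSpaces.Torus.continuous_uncurry_of_continuous_stLift hφ.continuous)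
  have hI₂ := h.integrable_weakIntegrand_of_continuous (Φ₂ := fun t => FunctionSpaces.Torus.gradient (φ t))
    (Φ₃ := fun t x => ∑ i, a i * FunctionSpaces.Torus.partialDeriv i
      (FunctionSpaces.Torus.partialDeriv i (φ t)) x)
    (continuous_uncurry_timeDeriv_of_contDiff_stLift' hφ) (continuous_uncurry_gradient_of_contDiff_stLift hφ)
    (continuous_uncurry_diagOp_of_contDiff_stLift hφ a)
  have hI₃ := h.integrable_source_mul_of_continuous (FunctionSpaces.Torus.continuous_uncurry_of_continuous_stLift hφ.continuous)
  have hf₁i : Integrable f₁ P :=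
    hI₁.bdd_mul ((hη.continuous_deriv (by simp)).comp continuous_fst).aestronglyMeasurable
      (Eventually.of_forall fun p => hCa p.1)
  have hf₂i : Integrable f₂ P :=
    hI₂.bdd_mul (hη.continuous.comp continuous_fst).aestronglyMeasurable
      (Eventually.of_forall fun p => hCb p.1)
  have hf₃i : Integrable f₃ P :=
    hI₃.bdd_mul (hη.continuous.comp continuous_fst).aestronglyMeasurable
      (Eventually.of_forall fun p => hCb p.1)
  have esum : (∫ p, (f₁ p + f₂ p) ∂P) + (∫ p, f₃ p ∂P) + η 0 * ∫ x, θ₀ x * φ 0 x = 0 := by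
    have e1 : ∫ p, (f₁ p + f₂ p) ∂P = ∫ p, θ p.1 p.2 *
        (FunctionSpaces.Torus.timeDeriv (fun t x => η t * φ t x) p.1 p.2 +
          ⟪u p.1 p.2, FunctionSpaces.Torus.gradient ((fun t x => η t * φ t x) p.1) p.2⟫_ℝ +
          κ * ∑ i, a i * FunctionSpaces.Torus.partialDeriv i
            (FunctionSpaces.Torus.partialDeriv i ((fun t x => η t * φ t x) p.1)) p.2) ∂P :=
      integral_congr_ae (Eventually.of_forall fun p => (hpt p).symm)
    have e2 : η 0 * ∫ x, θ₀ x * φ 0 x = ∫ x, θ₀ x * (fun t x => η t * φ t x) 0 x := by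
      rw [← integral_const_mul]
      exact integral_congr_ae (Eventually.of_forall fun x => by simp only; ring)
    have e3 : ∫ p, f₃ p ∂P = ∫ p, s p.1 p.2 * (fun t x => η t * φ t x) p.1 p.2 ∂P :=
      integral_congr_ae (Eventually.of_forall fun p => (hps p).symm)
    rw [e1, e2, e3]
    exact key
  have e₁ : ∫ p, f₁ p ∂P = ∫ t in Ioo 0 T, deriv η t * ∫ x, θ t x * φ t x := by
    rw [hP, integral_prod _ hf₁i]
    refine integral_congr_ae (Eventually.of_forall fun t => ?_)
    simp only [hf₁]
    exact integral_const_mul _ _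
  have e₂ : ∫ p, f₂ p ∂P = ∫ t in Ioo 0 T, η t * ∫ x, θ t x * (FunctionSpaces.Torus.timeDeriv φ t x +
      ⟪u t x, FunctionSpaces.Torus.gradient (φ t) x⟫_ℝ +
      κ * ∑ i, a i * FunctionSpaces.Torus.partialDeriv i
        (FunctionSpaces.Torus.partialDeriv i (φ t)) x) := by
    rw [hP, integral_prod _ hf₂i]
    refine integral_congr_ae (Eventually.of_forall fun t => ?_)
    simp only [hf₂]
    exact integral_const_mul _ _
  have e₃ : ∫ p, f₃ p ∂P = ∫ t in Ioo 0 T, η t * ∫ x, s t x * φ t x := by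
    rw [hP, integral_prod _ hf₃i]
    refine integral_congr_ae (Eventually.of_forall fun t => ?_)
    simp only [hf₃]
    exact integral_const_mul _ _
  have ha : Integrable (fun t => deriv η t * ∫ x, θ t x * φ t x) (volume.restrict (Ioo 0 T)) := by
    refine hf₁i.integral_prod_left.congr (Eventually.of_forall fun t => ?_)
    simp only [hf₁]
    exact integral_const_mul _ _
  have hb : Integrable (fun t => η t * ∫ x, θ t x * (FunctionSpaces.Torus.timeDeriv φ t x +
      ⟪u t x, FunctionSpaces.Torus.gradient (φ t) x⟫_ℝ +
      κ * ∑ i, a i * FunctionSpaces.Torus.partialDeriv i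
        (FunctionSpaces.Torus.partialDeriv i (φ t)) x)) (volume.restrict (Ioo 0 T)) := by
    refine hf₂i.integral_prod_left.congr (Eventually.of_forall fun t => ?_)
    simp only [hf₂]
    exact integral_const_mul _ _
  have hc : Integrable (fun t => η t * ∫ x, s t x * φ t x) (volume.restrict (Ioo 0 T)) := by
    refine hf₃i.integral_prod_left.congr (Eventually.of_forall fun t => ?_)
    simp only [hf₃]
    exact integral_const_mul _ _
  rw [integral_add hf₁i hf₂i, e₁, e₂, e₃] at esum
  have esplit : ∀ t, (deriv η t * ∫ x, θ t x * φ t x) +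
      η t * ((∫ x, θ t x * (FunctionSpaces.Torus.timeDeriv φ t x +
        ⟪u t x, FunctionSpaces.Torus.gradient (φ t) x⟫_ℝ +
        κ * ∑ i, a i * FunctionSpaces.Torus.partialDeriv i
          (FunctionSpaces.Torus.partialDeriv i (φ t)) x)) + ∫ x, s t x * φ t x) =
      ((deriv η t * ∫ x, θ t x * φ t x) +
        η t * ∫ x, θ t x * (FunctionSpaces.Torus.timeDeriv φ t x +
          ⟪u t x, FunctionSpaces.Torus.gradient (φ t) x⟫_ℝ +
          κ * ∑ i, a i * FunctionSpaces.Torus.partialDeriv i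
            (FunctionSpaces.Torus.partialDeriv i (φ t)) x)) + η t * ∫ x, s t x * φ t x :=
    fun t => by ring
  have hab : Integrable (fun t => (deriv η t * ∫ x, θ t x * φ t x) +
      η t * ∫ x, θ t x * (FunctionSpaces.Torus.timeDeriv φ t x +
        ⟪u t x, FunctionSpaces.Torus.gradient (φ t) x⟫_ℝ +
        κ * ∑ i, a i * FunctionSpaces.Torus.partialDeriv i
          (FunctionSpaces.Torus.partialDeriv i (φ t)) x)) (volume.restrict (Ioo 0 T)) := ha.add hb
  simp_rw [esplit]
  rw [integral_add hab hc, integral_add ha hb]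
  linarith

/-! ## The absolutely continuous representatives -/

/-- **A weak solution paired with a smooth time-dependent field is absolutely continuous in
time**: for a field `φ` with smooth space–time lift and a.e. `t ∈ (0,T)`,
`∫ θ(t) φ(t) = ∫ θ₀ φ(0) + ∫_{(0,t]} (∫ θ(τ) (∂ₜφ(τ) + ⟪u(τ), ∇φ(τ)⟫ + κ ∑ᵢ aᵢ ∂ᵢ∂ᵢφ(τ)) + ∫ s(τ) φ(τ)) dτ`
(`setIntegral_test_mul_spaceTime` and the a.e. du Bois-Reymond lemma with datum).
[cite: DiPernaLions1989, §II.1 (13)–(14)] -/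
theorem ae_integral_mul_spaceTime_eq (h : IsWeakScalarTransportDiagForcedOn T a κ u s θ₀ θ)
    (hφ : ContDiff ℝ ∞ (FunctionSpaces.Torus.stLift φ)) :
    ∀ᵐ t ∂(volume.restrict (Ioo 0 T)),
      ∫ x, θ t x * φ t x = (∫ x, θ₀ x * φ 0 x) +
        ∫ τ in Ioc 0 t, ((∫ x, θ τ x * (FunctionSpaces.Torus.timeDeriv φ τ x +
          ⟪u τ x, FunctionSpaces.Torus.gradient (φ τ) x⟫_ℝ +
          κ * ∑ i, a i * FunctionSpaces.Torus.partialDeriv i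
            (FunctionSpaces.Torus.partialDeriv i (φ τ)) x)) + ∫ x, s τ x * φ τ x) := by
  have hU : IntegrableOn (fun t => ∫ x, θ t x * φ t x) (Ioo 0 T) volume :=
    (h.integrable_mul_of_continuous (FunctionSpaces.Torus.continuous_uncurry_of_continuous_stLift hφ.continuous)).integral_prod_left
  have hF : IntegrableOn (fun t => (∫ x, θ t x * (FunctionSpaces.Torus.timeDeriv φ t x +
      ⟪u t x, FunctionSpaces.Torus.gradient (φ t) x⟫_ℝ +
      κ * ∑ i, a i * FunctionSpaces.Torus.partialDeriv i
        (FunctionSpaces.Torus.partialDeriv i (φ t)) x)) + ∫ x, s t x * φ t x) (Ioo 0 T) volume :=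
    (h.integrable_weakIntegrand_of_continuous (Φ₂ := fun t => FunctionSpaces.Torus.gradient (φ t))
      (Φ₃ := fun t x => ∑ i, a i * FunctionSpaces.Torus.partialDeriv i
        (FunctionSpaces.Torus.partialDeriv i (φ t)) x)
      (continuous_uncurry_timeDeriv_of_contDiff_stLift' hφ) (continuous_uncurry_gradient_of_contDiff_stLift hφ)
      (continuous_uncurry_diagOp_of_contDiff_stLift hφ a)).integral_prod_left.add
      (h.integrable_source_mul_of_continuous (FunctionSpaces.Torus.continuous_uncurry_of_continuous_stLift hφ.continuous)).integral_prod_left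
  exact FunctionSpaces.ae_eq_add_setIntegral_of_forall_test hU hF fun η hη hηc hηT =>
    h.setIntegral_test_mul_spaceTime hη hηc hηT hφ

/-- **A weak solution paired with a steady smooth field is absolutely continuous in time**:
for a.e. `t ∈ (0,T)`,
`∫ θ(t) g = ∫ θ₀ g + ∫_{(0,t]} (∫ θ(τ) (⟪u(τ), ∇g⟫ + κ ∑ᵢ aᵢ ∂ᵢ∂ᵢ g) + ∫ s(τ) g) dτ`
(the case `φ(t) = g` of `ae_integral_mul_spaceTime_eq`; twin of
`IsWeakScalarTransportForcedOn.ae_integral_mul_eq`). [cite: DiPernaLions1989, §II.1 (13)–(14)] -/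
theorem ae_integral_mul_eq (h : IsWeakScalarTransportDiagForcedOn T a κ u s θ₀ θ)
    {g : UnitAddTorus d → ℝ} (hg : FunctionSpaces.Torus.IsSmooth g) :
    ∀ᵐ t ∂(volume.restrict (Ioo 0 T)),
      ∫ x, θ t x * g x = (∫ x, θ₀ x * g x) +
        ∫ τ in Ioc 0 t, ((∫ x, θ τ x *
          (⟪u τ x, FunctionSpaces.Torus.gradient g x⟫_ℝ +
            κ * ∑ i, a i * FunctionSpaces.Torus.partialDeriv i (FunctionSpaces.Torus.partialDeriv i g) x)) +
          ∫ x, s τ x * g x) := by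
  have hφ : ContDiff ℝ ∞ (FunctionSpaces.Torus.stLift (fun _ : ℝ => g)) :=
    (hg : ContDiff ℝ ∞ (FunctionSpaces.Torus.lift g)).comp contDiff_snd
  have htD : ∀ (τ : ℝ) (x : UnitAddTorus d), FunctionSpaces.Torus.timeDeriv (fun _ : ℝ => g) τ x = 0 := by
    intro τ x
    simp [FunctionSpaces.Torus.timeDeriv]
  filter_upwards [h.ae_integral_mul_spaceTime_eq hφ] with t ht
  simpa only [htD, zero_add] using ht

/-- **Conservation of the mean up to the injected mass**: for a.e. `t ∈ (0,T)`,
`∫ θ(t) = ∫ θ₀ + ∫_{(0,t]} ∫ s(τ) dτ` (`g = 1`: `∇1 = 0`, `∂ᵢ∂ᵢ1 = 0`); for a mean-zero source the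
scalar mean is constant (DEIJ 2022, §1). [cite: DEIJ2022, §1 (1.1)] -/
theorem ae_integral_eq (h : IsWeakScalarTransportDiagForcedOn T a κ u s θ₀ θ) :
    ∀ᵐ t ∂(volume.restrict (Ioo 0 T)),
      ∫ x, θ t x = (∫ x, θ₀ x) + ∫ τ in Ioc 0 t, ∫ x, s τ x := by
  have h1 := h.ae_integral_mul_eq (FunctionSpaces.Torus.isSmooth_const (1 : ℝ))
  have hg0 : ∀ x : UnitAddTorus d, FunctionSpaces.Torus.gradient (fun _ : UnitAddTorus d => (1 : ℝ)) x = 0 := by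
    intro x
    have hl : FunctionSpaces.Torus.liftAt (fun _ : UnitAddTorus d => (1 : ℝ)) x = fun _ => 1 := by
      funext v; simp [FunctionSpaces.Torus.liftAt_apply]
    simp [FunctionSpaces.Torus.gradient, hl]
  have hl0 : ∀ (i : d) (x : UnitAddTorus d), FunctionSpaces.Torus.partialDeriv i
      (FunctionSpaces.Torus.partialDeriv i (fun _ : UnitAddTorus d => (1 : ℝ))) x = 0 := by
    intro i x
    simp [FunctionSpaces.Torus.partialDeriv, FunctionSpaces.Torus.lineDeriv]
  filter_upwards [h1] with t ht
  simpa [hg0, hl0] using ht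

end IsWeakScalarTransportDiagForcedOn

end Torus

end Literature.Analysis.FluidPDE

end
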